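import Mathlib
import HarnessLib

/-!
# Hyperderivatives for Stepanov's method (Schmidt, Ch. I §6) — PROVED

Topic `NumberTheory/LFunctions` (auxiliary to the Stepanov–Schmidt point count, Schmidt's
Theorem I.2A, the tree's named fact `Literature.NumberTheory.LFunctions.Schmidt1976.theorem_I_2A_two`).
W. M. Schmidt, *Equations over Finite Fields. An Elementary Approach*, LNM 536 (1976), Ch. I
§6 "Hyperderivatives" (pp. 27–31) — Mathlib's `Polynomial.hasseDeriv` is Schmidt's `E^{(ℓ)}`
(`E^{(ℓ)} X^t = (t choose ℓ) X^{t−ℓ}`, Lemma 6A = `Polynomial.hasseDeriv_mul`).  We PROVE: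

* `dvd_of_hasseDeriv_eval_eq_zero` — **Theorem 6D**: if `E^{(ℓ)} f (x) = 0` for `ℓ = 0, …, M − 1`
  then `(X − x)^M ∣ f` (via `Polynomial.taylor_coeff`);
* `pow_dvd_hasseDeriv_pow`, `pow_dvd_hasseDeriv_mul_pow`, `natDegree_div_le` — **Corollary 6C**:
  `E^{(ℓ)}(a f^t) = b f^{t−ℓ}` with `deg b ≤ deg a + ℓ (deg f − 1)`;
* `choose_mul_card_pow_eq_zero`, `hasseDeriv_X_pow_mul_card`, `hasseDeriv_mul_X_pow_mul_card` —
  **Lemma 6E** (the case used in §7): for `0 < ℓ < q = p^κ`, `E^{(ℓ)}(X^{qj}) = 0`, hence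
  `E^{(ℓ)}(u · X^{qj}) = E^{(ℓ)}(u) · X^{qj}` for `ℓ < q` (`X^{qj}` behaves as a constant).

## References

* W. M. Schmidt, *Equations over Finite Fields. An Elementary Approach*, Lecture Notes in
  Math. 536, Springer (1976), Ch. I §6: Lemma 6A, Corollaries 6B, 6C, Theorem 6D, Lemma 6E.
* H. Hasse, *Theorie der höheren Differentiale in einem algebraischen Funktionenkörper mit
  vollkommenem Konstantenkörper bei beliebiger Charakteristik*, J. reine angew. Math. 175 (1936).
-/

noncomputable section

open Finset Polynomial

namespace Literature.NumberTheory.LFunctions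

namespace Stepanov

/-! ### Theorem 6D: vanishing hyperderivatives give a zero of high order -/

section SixD

variable {R : Type*} [CommRing R]

/-- **Schmidt, Ch. I, Theorem 6D.**  *Suppose `E^{(ℓ)}(f)(x) = 0` for `ℓ = 0, 1, …, M − 1`.  Then
`(X − x)^M` divides `f(X)`.* [cite: Schmidt1976, Ch. I §6, Theorem 6D, p. 29] -/
theorem dvd_of_hasseDeriv_eval_eq_zero {f : R[X]} {x : R} {M : ℕ}
    (h : ∀ ℓ < M, (hasseDeriv ℓ f).eval x = 0) : (X - C x) ^ M ∣ f := by
  rcases eq_or_ne f 0 with rfl | hf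
  · exact dvd_zero _
  rw [← le_rootMultiplicity_iff hf, rootMultiplicity_eq_natTrailingDegree, ← taylor_apply]
  refine le_natTrailingDegree ((taylor_eq_zero x f).not.mpr hf) fun ℓ hℓ => ?_
  rw [taylor_coeff]
  exact h ℓ hℓ

variable [IsDomain R]

/-- Conversely-flavoured bookkeeping: the multiplicities of the zeros of `r ≠ 0` in a finite set
add up to at most `deg r` ("the number of zeros of `r(X)`, counted with multiplicities, cannot
exceed its degree", Schmidt I §4). [cite: Schmidt1976, Ch. I §4, p. 19] -/
theorem card_mul_le_natDegree_of_pow_dvd [DecidableEq R] {r : R[X]} (hr : r ≠ 0) (S : Finset R)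
    {M : ℕ} (h : ∀ x ∈ S, (X - C x) ^ M ∣ r) : S.card * M ≤ r.natDegree := by
  calc S.card * M = ∑ x ∈ S, M := by rw [Finset.sum_const, smul_eq_mul]
    _ ≤ ∑ x ∈ S, r.roots.count x := Finset.sum_le_sum fun x hx => by
        rw [count_roots]; exact (le_rootMultiplicity_iff hr).mpr (h x hx)
    _ ≤ ∑ x ∈ r.roots.toFinset, r.roots.count x :=
        Finset.sum_le_sum_of_ne_zero fun x _ hx =>
          Multiset.mem_toFinset.mpr (Multiset.count_ne_zero.mp hx)
    _ = Multiset.card r.roots := (Multiset.toFinset_sum_count_eq _)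
    _ ≤ r.natDegree := card_roots' r

end SixD

/-! ### Corollary 6C: `E^{(ℓ)}(a f^t) = b f^{t−ℓ}` -/

section SixC

variable {R : Type*} [CommRing R]

/-- `f^{t−j} ∣ E^{(j)}(f^t)` (Schmidt's Corollary 6C with `a = 1`; for `j > t` the statement is
trivial as `t − j = 0`). [cite: Schmidt1976, Ch. I §6, Corollary 6C, p. 28] -/
theorem pow_dvd_hasseDeriv_pow (f : R[X]) : ∀ t j : ℕ, f ^ (t - j) ∣ hasseDeriv j (f ^ t) := by
  intro t
  induction t with
  | zero => intro j; rw [Nat.zero_sub, pow_zero]; exact one_dvd _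
  | succ t ih =>
    intro j
    rw [pow_succ, hasseDeriv_mul]
    refine Finset.dvd_sum fun ij hij => ?_
    rw [Finset.HasAntidiagonal.mem_antidiagonal] at hij
    obtain ⟨i, i'⟩ := ij
    dsimp only at hij ⊢
    rcases Nat.eq_zero_or_pos i' with h0 | hpos
    · -- `i' = 0`, `i = j`: `E^{(j)}(f^t) · f`
      subst h0
      rw [hasseDeriv_zero', add_zero] at *
      subst hij
      rcases le_or_gt i t with hit | hit
      · rw [show t + 1 - i = (t - i) + 1 by omega, pow_succ]
        exact mul_dvd_mul (ih i) dvd_rfl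
      · rw [show t + 1 - i = 0 by omega, pow_zero]
        exact one_dvd _
    · -- `i < j`: `E^{(i)}(f^t)` already carries `f^{t−i}`, `t − i ≥ t + 1 − j`
      refine Dvd.dvd.mul_right ?_ _
      exact (pow_dvd_pow f (by omega)).trans (ih i)

/-- **Schmidt, Ch. I, Corollary 6C** (divisibility part): `f^{t−ℓ} ∣ E^{(ℓ)}(a · f^t)`.
[cite: Schmidt1976, Ch. I §6, Corollary 6C, p. 28] -/
theorem pow_dvd_hasseDeriv_mul_pow (a f : R[X]) (t ℓ : ℕ) :
    f ^ (t - ℓ) ∣ hasseDeriv ℓ (a * f ^ t) := by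
  rw [hasseDeriv_mul]
  refine Finset.dvd_sum fun ij hij => ?_
  rw [Finset.HasAntidiagonal.mem_antidiagonal] at hij
  refine Dvd.dvd.mul_left ?_ _
  exact (pow_dvd_pow f (by omega)).trans (pow_dvd_hasseDeriv_pow f t ij.2)

variable [IsDomain R]

/-- **Schmidt, Ch. I, Corollary 6C** (degree part): if `E^{(ℓ)}(a f^t) = b f^{t−ℓ}` with `ℓ ≤ t`
then `deg b ≤ deg a + ℓ (deg f − 1)`. [cite: Schmidt1976, Ch. I §6, Corollary 6C, p. 28] -/
theorem natDegree_le_of_hasseDeriv_mul_pow_eq {a f b : R[X]} {t ℓ : ℕ} (hℓ : ℓ ≤ t) (hf : f ≠ 0)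
    (h : hasseDeriv ℓ (a * f ^ t) = b * f ^ (t - ℓ)) :
    b.natDegree ≤ a.natDegree + ℓ * (f.natDegree - 1) := by
  rcases eq_or_ne b 0 with rfl | hb
  · simp
  rcases eq_or_ne a 0 with rfl | ha
  · rw [zero_mul, map_zero, eq_comm, mul_eq_zero] at h
    rcases h with h | h
    · exact (hb h).elim
    · exact (pow_ne_zero _ hf h).elim
  have hdeg := natDegree_hasseDeriv_le (a * f ^ t) ℓ
  rw [h, natDegree_mul hb (pow_ne_zero _ hf), natDegree_pow, natDegree_mul ha (pow_ne_zero _ hf),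
    natDegree_pow] at hdeg
  -- `deg b + (t − ℓ) m ≤ deg a + t m − ℓ`
  rcases Nat.eq_zero_or_pos f.natDegree with hm | hm
  · rw [hm] at hdeg ⊢
    simp only [mul_zero, add_zero, Nat.zero_sub] at hdeg ⊢
    omega
  · have key : b.natDegree + (t - ℓ) * f.natDegree ≤ a.natDegree + t * f.natDegree - ℓ := hdeg
    have h1 : (t - ℓ) * f.natDegree + ℓ * f.natDegree = t * f.natDegree := by
      rw [← Nat.add_mul, Nat.sub_add_cancel hℓ]
    have h2 : ℓ ≤ ℓ * f.natDegree := Nat.le_mul_of_pos_right ℓ hm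
    have h3 : ℓ * (f.natDegree - 1) = ℓ * f.natDegree - ℓ := Nat.mul_sub_one ℓ f.natDegree
    omega

end SixC

/-! ### Lemma 6E: `X^{qj}` is a hyperderivative constant below order `q = p^κ` -/

section SixE

variable {F : Type*} [Field F] [Fintype F]

/-- In `𝔽_q[X]`: `(1 + X)^{qj} = (1 + X^q)^j`, so `(qj choose ℓ) = 0` in `𝔽_q` for `0 < ℓ < q`
(the computation behind Lemma 6E: "`(p^μ choose ℓ)` is `0` in a field of characteristic `p`").
[cite: Schmidt1976, Ch. I §6, Lemma 6E, p. 29] -/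
theorem choose_card_mul_eq_zero {ℓ : ℕ} (h0 : 0 < ℓ) (hq : ℓ < Fintype.card F) (j : ℕ) :
    ((Fintype.card F * j).choose ℓ : F) = 0 := by
  obtain ⟨p, hchar⟩ := CharP.exists F
  haveI := hchar
  obtain ⟨n, hp, hcard⟩ := FiniteField.card F p
  haveI : Fact p.Prime := ⟨hp⟩
  set q := Fintype.card F with hqdef
  -- compare the coefficients of `X^ℓ` in `(1 + X)^{qj} = ((1 + X)^q)^j = (1 + X^q)^j`
  have hfrob : ((1 + X : F[X]) ^ q) = 1 + X ^ q := by
    rw [hcard, add_pow_char_pow, one_pow]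
  have hexp : ((1 + X : F[X]) ^ (q * j)) = expand F q ((1 + X) ^ j) := by
    rw [pow_mul, hfrob, map_pow, map_add, map_one, expand_X]
  have hcoeff := congrArg (fun P : F[X] => P.coeff ℓ) hexp
  rw [coeff_one_add_X_pow, coeff_expand (hqdef ▸ Fintype.card_pos), if_neg] at hcoeff
  · exact hcoeff
  · exact Nat.not_dvd_of_pos_of_lt h0 hq

/-- **Schmidt, Ch. I, Lemma 6E** (monomial case): `E^{(ℓ)}(X^{qj}) = 0` for `0 < ℓ < q = |𝔽_q|`.
[cite: Schmidt1976, Ch. I §6, Lemma 6E, p. 29] -/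
theorem hasseDeriv_X_pow_card_mul {ℓ : ℕ} (h0 : 0 < ℓ) (hq : ℓ < Fintype.card F) (j : ℕ) :
    hasseDeriv ℓ ((X : F[X]) ^ (Fintype.card F * j)) = 0 := by
  rw [X_pow_eq_monomial, hasseDeriv_monomial, choose_card_mul_eq_zero h0 hq j, zero_mul,
    monomial_zero_right]

/-- **Schmidt, Ch. I, Lemma 6E** (the form used in §7): for `ℓ < q`,
`E^{(ℓ)}(u · X^{qj}) = E^{(ℓ)}(u) · X^{qj}`. [cite: Schmidt1976, Ch. I §6, Lemma 6E, p. 29] -/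
theorem hasseDeriv_mul_X_pow_card_mul {ℓ : ℕ} (hq : ℓ < Fintype.card F) (u : F[X]) (j : ℕ) :
    hasseDeriv ℓ (u * X ^ (Fintype.card F * j)) =
      hasseDeriv ℓ u * X ^ (Fintype.card F * j) := by
  rw [hasseDeriv_mul, Finset.Nat.sum_antidiagonal_eq_sum_range_succ_mk, Finset.sum_range_succ,
    Finset.sum_eq_zero, zero_add, Nat.sub_self, hasseDeriv_zero']
  intro i hi
  rw [Finset.mem_range] at hi
  dsimp only
  rw [hasseDeriv_X_pow_card_mul (by omega) (by omega), mul_zero]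

/-- Iterating Lemma 6E over a sum: `E^{(ℓ)}(Σ_j u_j X^{qj}) = Σ_j E^{(ℓ)}(u_j) X^{qj}` for `ℓ < q`.
[cite: Schmidt1976, Ch. I §6, Lemma 6E, p. 29] -/
theorem hasseDeriv_sum_mul_X_pow_card_mul {ℓ : ℕ} (hq : ℓ < Fintype.card F) {ι : Type*}
    (s : Finset ι) (u : ι → F[X]) (e : ι → ℕ) :
    hasseDeriv ℓ (∑ j ∈ s, u j * X ^ (Fintype.card F * e j)) =
      ∑ j ∈ s, hasseDeriv ℓ (u j) * X ^ (Fintype.card F * e j) := by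
  rw [map_sum]
  exact Finset.sum_congr rfl fun j _ => hasseDeriv_mul_X_pow_card_mul hq (u j) (e j)

/-- In `𝔽_q`, `x^{qj} = x^j`. [folklore] -/
theorem pow_card_mul (x : F) (j : ℕ) : x ^ (Fintype.card F * j) = x ^ j := by
  rw [pow_mul, FiniteField.pow_card]

end SixE

end Stepanov

end Literature.NumberTheory.LFunctions
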